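import Literature.IUT.HodgeTheaters.TemperedCoveringsCor23LevelsSub
import Literature.IUT.HodgeTheaters.CommensuratorLemmas
import HarnessLib

/-!
# [IUTchI] Cor. 2.3 at the levels of the Prop. 2.4 tower — PROOFS companion of the sub-DAG statements

Mochizuki, *Inter-universal Teichmüller theory I: construction of Hodge theaters*, kurims manuscript (May
2020), §2, Cor. 2.3 (i)/(vi) pp. 47–48 and the levels of the proof of Prop. 2.4 (i) p. 50
([IUTchI] Cor 2.3 pp.47-49) [claim: Mochizuki2012, status: disputed]; consumed by *Inter-universal
Teichmüller theory II* §2 Cor. 2.4 (i), proof p. 70 l. −2 – p. 71 l. 3 ([IUTchII] Cor 2.4(i) pp.70-71)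
[claim: Mochizuki2012, status: disputed] (D-0012 claim key; nothing of the series is asserted).
PROOF-ONLY companion (no definitions) of `TemperedCoveringsCor23LevelsSub.lean` (p418158,
plan/L5/SUBDAG-IUTchI-Cor23Levels.md; seat abc-iut-L5-t11):

* `commensurator_inf_subgroupOf_eq_of_finiteIndex` — commensurable terminality passes from `G` to a
  finite-index `J ≤ G` (`H ∩ J` in `J`), pure group theory;
* `Prop24Tower.levelTp_finiteIndex` — the levels `J_i ⊆ Δ^tp_X` have finite index (open levels in the profinite
  `Δ̂_X`);
* `Prop24Tower.levelCommTerminal_of_cor23i(_of_open)` — sub-node **B2 DERIVED** from BASE-level Cor. 2.3 (i)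
  (abc-iut-L5-t1's `Cor23i`) + finite index of the levels: B2 is NOT an independent input of the sub-DAG.
  (The B2 predicate landed as `SubgraphLevelData.LevelCommTerminal` with the tower implicit — it does not
  depend on the level subgraph data — so it is addressed here as `SubgraphLevelData.LevelCommTerminal (T := T)`.)
* `SubgraphLevelData.levelTarget_of_comps` — B4-L5 straight from the component combinatorics;
* `SubgraphLevelData.trivialLevelData_props` — a SHAPE witness: the one-vertex level data satisfy every
  combinatorial predicate, and satisfy B1 (c) `StabLeDeltaHLevel` iff `Δ^tp_X = Δ^tp_{X,ℍ}·J_i` at every level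
  (so the dictionary B1 (c) is where the content sits; the predicates are jointly consistent).
Nothing here bears on [IUTchIII] Cor. 3.12; typed ≠ discharged.
-/

namespace Literature.IUT.HodgeTheaters

open Pointwise
open _root_.Topology
open Literature.AnabelianGeometry.AbsoluteAnabelian (IsCommensurablyTerminal)

universe u

/-- **Commensurable terminality passes to a finite-index level**: if `H` is commensurably terminal in `G`
and `J ≤ G` has finite index, then `H ∩ J` is commensurably terminal in `J` (for `j ∈ J` commensurating
`H ∩ J`: `H ∩ J` is commensurable with `H`, so `j` commensurates `H`, so `j ∈ H`). [cite: Mochizuki2012, Cor 2.3(i) p.47] -/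
theorem commensurator_inf_subgroupOf_eq_of_finiteIndex {G : Type*} [Group G] {H : Subgroup G}
    (J : Subgroup G) [J.FiniteIndex] (hH : Subgroup.Commensurable.commensurator H = H) :
    Subgroup.Commensurable.commensurator ((H ⊓ J).subgroupOf J) = (H ⊓ J).subgroupOf J := by
  refine isCommensurablyTerminal_of_le fun j hj => ?_
  rw [Subgroup.Commensurable.commensurator_mem_iff] at hj
  have hmap : ((H ⊓ J).subgroupOf J).map J.subtype = H ⊓ J := by
    rw [Subgroup.subgroupOf_map_subtype, inf_assoc, inf_idem]
  -- push the commensurability down to `G`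
  obtain ⟨h1, h2⟩ := hj
  rw [← Subgroup.relIndex_map_map_of_injective _ _ J.subtype_injective, map_conjAct_smul, hmap] at h1 h2
  have hjG : (j : G) ∈ Subgroup.Commensurable.commensurator (H ⊓ J) := by
    rw [Subgroup.Commensurable.commensurator_mem_iff]
    exact ⟨h1, h2⟩
  -- `H ∩ J` is commensurable with `H` (finite index), so the commensurators agree
  have hcomm : Subgroup.Commensurable (H ⊓ J) H := by
    constructor
    · rw [Subgroup.inf_relIndex_left]
      exact (inferInstance : (J.subgroupOf H).FiniteIndex).index_ne_zero
    · rw [Subgroup.relIndex_eq_one.mpr inf_le_left]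
      exact one_ne_zero
  rw [hcomm.eq, hH] at hjG
  exact Subgroup.mem_subgroupOf.mpr ⟨hjG, j.2⟩

namespace StableCurveTemperedData

variable {D : StableCurveTemperedData.{u}}

namespace Prop24Tower

variable (T : D.Prop24Tower)

/-- The monoid-hom identity behind `levelTp`: `Δ̂_X.subtype ∘ ι_Δ = ι ∘ Δ^tp_X.subtype`.
[cite: Mochizuki2012, §2 p.47] -/
theorem levelTp_eq_comap_ιΔ (i : T.I) :
    D.levelTp (T.Jhat i) = ((T.Jhat i).subgroupOf D.DeltaHat).comap D.ιΔ := by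
  ext x
  rw [D.mem_levelTp, Subgroup.mem_comap, Subgroup.mem_subgroupOf, coe_ιΔ]

/-- **The levels `J_i ⊆ Δ^tp_X` have finite index** ("finite index characteristic open subgroups", p. 50
l. 27): from `LevelsOpen` (`Ĵ_i ∩ Δ̂_X` open in the compact `Δ̂_X`, hence of finite index) and the injection
`Δ^tp_X/J_i ↪ Δ̂_X/(Ĵ_i ∩ Δ̂_X)`. PROVED. [cite: Mochizuki2012, Prop 2.4(i) p.50] -/
theorem levelTp_finiteIndex (hΔc : D.DeltaHatClosed) (ho : T.LevelsOpen) (i : T.I) :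
    (D.levelTp (T.Jhat i)).FiniteIndex := by
  haveI : CompactSpace D.DeltaHat := isCompact_iff_compactSpace.mp hΔc.isCompact
  set J' : Subgroup D.DeltaHat := (T.Jhat i).subgroupOf D.DeltaHat with hJ'
  haveI : Finite (D.DeltaHat ⧸ J') := Subgroup.quotient_finite_of_isOpen _ (ho i)
  haveI hJ'fi : J'.FiniteIndex := Subgroup.finiteIndex_of_finite_quotient
  rw [T.levelTp_eq_comap_ιΔ i]
  refine ⟨?_⟩
  rw [Subgroup.index_comap]
  exact (inferInstance : (J'.subgroupOf D.ιΔ.range).FiniteIndex).index_ne_zero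

/-- **B2 DERIVED from BASE-level Cor. 2.3 (i)** and the finite index of the levels: `Δ^tp_{X,ℍ} ∩ J_i` is
commensurably terminal in `J_i` because `Δ^tp_{X,ℍ}` is commensurably terminal in `Δ^tp_X` (abc-iut-L5-t1's
`Cor23i`, clause `tp`) and `[Δ^tp_X : J_i] < ∞`.  So the sub-DAG row B2 is not an independent input.
[cite: Mochizuki2012, Cor 2.3(i) p.47] -/
theorem levelCommTerminal_of_cor23i (h23i : D.Cor23i) (hfin : ∀ i, (D.levelTp (T.Jhat i)).FiniteIndex) :
    SubgraphLevelData.LevelCommTerminal (T := T) := by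
  intro i
  haveI := hfin i
  exact ⟨commensurator_inf_subgroupOf_eq_of_finiteIndex (D.levelTp (T.Jhat i)) h23i.tp.commensurator_eq⟩

/-- B2 from base Cor. 2.3 (i), `Δ̂_X` closed (profinite) and open levels. [cite: Mochizuki2012, Cor 2.3(i) p.47] -/
theorem levelCommTerminal_of_cor23i_of_open (h23i : D.Cor23i) (hΔc : D.DeltaHatClosed)
    (ho : T.LevelsOpen) : SubgraphLevelData.LevelCommTerminal (T := T) :=
  T.levelCommTerminal_of_cor23i h23i (T.levelTp_finiteIndex hΔc ho)

namespace SubgraphLevelData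

variable {T} (L : T.SubgraphLevelData)

/-- **B4-L5 from the component combinatorics directly** (`CompsDisjoint` + `CompsInvariant` in place of
`IsBlock`). [cite: Mochizuki2012, Cor 2.3(vi) p.48] -/
theorem levelTarget_of_comps (h23i : D.Cor23i) (hinc : L.LevelIncidence) (hdisj : L.CompsDisjoint)
    (hinv : L.CompsInvariant) (hstab : L.StabLeDeltaHLevel) : T.LevelTarget :=
  L.levelTarget_of_inputs h23i hinc (L.isBlock_of_comps hdisj hinv) hstab

/-- SHAPE WITNESS (consistency of the combinatorial predicates, not of the node): over any tower, the
one-vertex level data — every `𝔾_{J_i}` collapsed to a point, `ℍ̃_i` = everything — satisfies `CompsDisjoint`,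
`CompsInvariant`, `IsBlock`, `LevelActsTrivially`, `DeltaHStabilizes` and `LevelIncidence`; it satisfies
`StabLeDeltaHLevel` iff `Δ^tp_X = Δ^tp_{X,ℍ}·J_i` at every level — so B1 (c) is where the content of the
dictionary sits. [cite: Mochizuki2012, Cor 2.3(vi) p.48] -/
theorem trivialLevelData_props (T : D.Prop24Tower) :
    let L : T.SubgraphLevelData :=
      { Vtx := fun _ => PUnit
        act := fun _ => 1
        comps := fun _ => {Set.univ}
        compH := fun _ => Set.univ
        compH_mem := fun _ => rfl
        vtxCusp := fun _ _ => PUnit.unit }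
    L.CompsDisjoint ∧ L.CompsInvariant ∧ L.IsBlock ∧ L.LevelActsTrivially ∧ L.DeltaHStabilizes ∧
      L.LevelIncidence ∧
      (L.StabLeDeltaHLevel ↔ ∀ i (γ : D.DeltaTp), ∃ k ∈ D.deltaTpH, k⁻¹ * γ ∈ D.levelTp (T.Jhat i)) := by
  refine ⟨?_, ?_, ?_, ?_, ?_, ?_, ?_⟩
  · intro i A hA B hB _
    rw [Set.mem_singleton_iff.mp hA, Set.mem_singleton_iff.mp hB]
  · intro i t A hA
    rw [Set.mem_singleton_iff.mp hA]
    simp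
  · intro i t _ v _
    exact Set.mem_univ _
  · intro i j _
    rfl
  · intro i k _ v _
    exact Set.mem_univ _
  · intro i x t _
    exact Set.mem_univ _
  · constructor
    · intro h i γ
      exact h i γ (fun v _ => Set.mem_univ _)
    · intro h i γ _
      exact h i γ

end SubgraphLevelData

end Prop24Tower

end StableCurveTemperedData

end Literature.IUT.HodgeTheaters
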